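import Summits.Langlands.Langlands.Theses.PurityCarving
import Mathlib.LinearAlgebra.Eigenspace.Minpoly
import Mathlib.Analysis.SpecialFunctions.Pow.Real

/-!
# PG `PureImpliesGeneric` (route PurityCarving, item stmt-Langlands-31689) — pure ⟹ generic

Deligne's primitive-vector argument (Weil II 1.6.x; Taylor–Yoshida 2007 p. 6, proof of Lemma 1.4(4)) for ONE
Weil–Deligne representation `r = (ρ, N)` on `ℂⁿ`: if `r` is pure of weight `c` for a Weil element `w₀` of non-zero
degree (the inlined predicate of the route: the `ρ(w₀)`-eigenspaces sorted by `‖μ‖ = q ^ (-(deg w₀ · a)/2)` span,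
and `N ^ i` is a bijection from the weight-`(c+i)` part onto the weight-`(c−i)` part for every `i`), then every
`f : ℂⁿ → ℂⁿ` with `f ∘ ρ(w) = q ^ deg w • ρ(w) ∘ f` for all `w` and `f N = N f` vanishes.

Mechanism (all elementary linear algebra, no named facts): from the Weil–Deligne relation
`ρ(w) N = q ^ deg w • N ρ(w)` the operator `N` LOWERS the weight label by `2` and such an `f` RAISES it by `2`
(under either sign of `deg w₀`); only finitely many weight parts are non-zero (finitely many eigenvalues and
`a ↦ q^(-(d a)/2)` is injective since `q > 1`, `d ≠ 0`); downward induction on `i ≥ 0`: for `x` of weight `c+i`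
write `x = p + N z` with `z` of weight `c+i+2` and `N^(i+1) p = 0` (surjectivity of `N^(i+2)`), then
`f (N z) = N (f z) = 0` by induction and `f p` has weight `c+i+2` with `N^(i+1) (f p) = f (N^(i+1) p) = 0`, so
`f p = 0` by injectivity of `N^(i+2) = N ∘ N^(i+1)` on that part; negative weights are `N^i`-images of positive ones.
-/

set_option linter.dupNamespace false -- project-wide option; `Summit.Langlands.Langlands` is the mandated namespace

namespace Summit.Langlands.Langlands.Theorems

open Module Module.End

namespace PureImpliesGenericProof

variable {V : Type*} [AddCommGroup V] [Module ℂ V]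

variable {T N f : End ℂ V}

/-! Throughout, `W : ℤ → Submodule ℂ V` is the weight filtration of the inlined purity predicate, pinned by the
hypothesis `hW : ∀ a, W a = ⨆ μ, ⨆ (_ : ‖μ‖ = q ^ (-(d·a)/2)), eigenspace T μ` (no auxiliary definition). -/

/-- If `T N = s • N T` pointwise then `N` maps the `μ`-eigenspace of `T` into the `s μ`-eigenspace. -/
theorem apply_mem_eigenspace_of_comm_smul {s : ℂ} (hTN : ∀ v, T (N v) = s • N (T v)) {μ : ℂ} {v : V}
    (hv : v ∈ eigenspace T μ) : N v ∈ eigenspace T (s * μ) := by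
  rw [mem_eigenspace_iff] at hv ⊢
  rw [hTN, hv, map_smul, smul_smul]

/-- If `f T = s • T f` pointwise with `s ≠ 0` then `f` maps the `μ`-eigenspace of `T` into the
`s⁻¹ μ`-eigenspace. -/
theorem apply_mem_eigenspace_of_comm_smul' {s : ℂ} (hs : s ≠ 0) (hfT : ∀ v, f (T v) = s • T (f v))
    {μ : ℂ} {v : V} (hv : v ∈ eigenspace T μ) : f v ∈ eigenspace T (s⁻¹ * μ) := by
  rw [mem_eigenspace_iff] at hv ⊢
  have h := hfT v
  rw [hv, map_smul] at h
  rw [mul_smul, h, smul_smul, inv_mul_cancel₀ hs, one_smul]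

/-- Norm bookkeeping: `‖q ^ d‖ · q ^ (-(d a)/2) = q ^ (-(d (a - 2))/2)`. -/
theorem zpow_mul_rpow {q : ℝ} (hq : 0 < q) (d a : ℤ) :
    q ^ d * q ^ (-((d : ℝ) * (a : ℝ)) / 2) = q ^ (-((d : ℝ) * ((a - 2 : ℤ) : ℝ)) / 2) := by
  rw [← Real.rpow_intCast, ← Real.rpow_add hq]
  congr 1; push_cast; ring

/-- Norm bookkeeping: `‖q ^ d‖⁻¹ · q ^ (-(d a)/2) = q ^ (-(d (a + 2))/2)`. -/
theorem zpow_inv_mul_rpow {q : ℝ} (hq : 0 < q) (d a : ℤ) :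
    (q ^ d)⁻¹ * q ^ (-((d : ℝ) * (a : ℝ)) / 2) = q ^ (-((d : ℝ) * ((a + 2 : ℤ) : ℝ)) / 2) := by
  rw [← Real.rpow_intCast, ← Real.rpow_neg hq.le, ← Real.rpow_add hq]
  congr 1; push_cast; ring

variable {qN : ℕ} {d : ℤ}

/-- `N` lowers the weight label by `2`. -/
theorem apply_mem_wt_sub_two {W : ℤ → Submodule ℂ V}
    (hW : ∀ a, W a = ⨆ μ : ℂ, ⨆ (_ : ‖μ‖ = (qN : ℝ) ^ (-((d : ℝ) * (a : ℝ)) / 2)), eigenspace T μ)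
    (hq : 0 < (qN : ℝ)) (hTN : ∀ v, T (N v) = ((qN : ℂ) ^ d) • N (T v))
    {a : ℤ} {v : V} (hv : v ∈ W a) : N v ∈ W (a - 2) := by
  have hle : W a ≤ (W (a - 2)).comap N := by
    rw [hW a, hW (a - 2)]
    refine iSup_le fun μ => iSup_le fun hμ => fun x hx => ?_
    have hx' := apply_mem_eigenspace_of_comm_smul hTN hx
    have hnorm : ‖((qN : ℂ) ^ d) * μ‖ = (qN : ℝ) ^ (-((d : ℝ) * ((a - 2 : ℤ) : ℝ)) / 2) := by
      rw [norm_mul, norm_zpow, Complex.norm_natCast, hμ, zpow_mul_rpow hq]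
    exact Submodule.mem_comap.mpr (Submodule.mem_iSup_of_mem _ (Submodule.mem_iSup_of_mem hnorm hx'))
  exact hle hv

/-- `f` raises the weight label by `2`. -/
theorem apply_mem_wt_add_two {W : ℤ → Submodule ℂ V}
    (hW : ∀ a, W a = ⨆ μ : ℂ, ⨆ (_ : ‖μ‖ = (qN : ℝ) ^ (-((d : ℝ) * (a : ℝ)) / 2)), eigenspace T μ)
    (hq : 0 < (qN : ℝ)) (hfT : ∀ v, f (T v) = ((qN : ℂ) ^ d) • T (f v))
    {a : ℤ} {v : V} (hv : v ∈ W a) : f v ∈ W (a + 2) := by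
  have hs : ((qN : ℂ) ^ d) ≠ 0 := zpow_ne_zero d (by exact_mod_cast hq.ne')
  have hle : W a ≤ (W (a + 2)).comap f := by
    rw [hW a, hW (a + 2)]
    refine iSup_le fun μ => iSup_le fun hμ => fun x hx => ?_
    have hx' := apply_mem_eigenspace_of_comm_smul' hs hfT hx
    have hnorm : ‖((qN : ℂ) ^ d)⁻¹ * μ‖ = (qN : ℝ) ^ (-((d : ℝ) * ((a + 2 : ℤ) : ℝ)) / 2) := by
      rw [norm_mul, norm_inv, norm_zpow, Complex.norm_natCast, hμ, zpow_inv_mul_rpow hq]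
    exact Submodule.mem_comap.mpr (Submodule.mem_iSup_of_mem _ (Submodule.mem_iSup_of_mem hnorm hx'))
  exact hle hv

/-- `N ^ j` lowers the weight label by `2 j`. -/
theorem pow_apply_mem_wt {W : ℤ → Submodule ℂ V}
    (hW : ∀ a, W a = ⨆ μ : ℂ, ⨆ (_ : ‖μ‖ = (qN : ℝ) ^ (-((d : ℝ) * (a : ℝ)) / 2)), eigenspace T μ)
    (hq : 0 < (qN : ℝ)) (hTN : ∀ v, T (N v) = ((qN : ℂ) ^ d) • N (T v))
    (j : ℕ) {a : ℤ} {v : V} (hv : v ∈ W a) : (N ^ j) v ∈ W (a - 2 * (j : ℤ)) := by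
  induction j with
  | zero => simpa only [pow_zero, Module.End.one_apply, Nat.cast_zero, mul_zero, sub_zero] using hv
  | succ j ih =>
    have h := apply_mem_wt_sub_two hW hq hTN ih
    have e : a - 2 * ((j + 1 : ℕ) : ℤ) = a - 2 * (j : ℤ) - 2 := by push_cast; ring
    rw [e, pow_succ', Module.End.mul_apply]
    exact h

/-- `f` commutes with every power of `N`. -/
theorem apply_pow_apply_comm (hfN : ∀ v, f (N v) = N (f v)) (j : ℕ) (v : V) :
    f ((N ^ j) v) = (N ^ j) (f v) := by
  induction j generalizing v with
  | zero => simp only [pow_zero, Module.End.one_apply]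
  | succ j ih => rw [pow_succ', Module.End.mul_apply, Module.End.mul_apply, hfN, ih]

/-- Only finitely many weight parts are non-zero: beyond some `B`, `W (c + i) = ⊥`. -/
theorem exists_wt_eq_bot [FiniteDimensional ℂ V] (T : End ℂ V) {q : ℝ} (hq : 1 < q) {d : ℝ}
    (hd : d ≠ 0) {W : ℤ → Submodule ℂ V}
    (hW : ∀ a, W a = ⨆ μ : ℂ, ⨆ (_ : ‖μ‖ = q ^ (-(d * (a : ℝ)) / 2)), eigenspace T μ)
    (c : ℤ) : ∃ B : ℕ, ∀ i : ℕ, B ≤ i → W (c + i) = ⊥ := by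
  have hfin : {a : ℤ | W a ≠ ⊥}.Finite := by
    refine ((finite_hasEigenvalue T).biUnion (t := fun μ => {a : ℤ | ‖μ‖ = q ^ (-(d * (a : ℝ)) / 2)})
      fun μ _ => ?_).subset ?_
    · refine Set.Subsingleton.finite fun a ha b hb => ?_
      simp only [Set.mem_setOf_eq] at ha hb
      have h : q ^ (-(d * (a : ℝ)) / 2) = q ^ (-(d * (b : ℝ)) / 2) := ha.symm.trans hb
      have hexp : -(d * (a : ℝ)) / 2 = -(d * (b : ℝ)) / 2 := by
        rcases lt_trichotomy (-(d * (a : ℝ)) / 2) (-(d * (b : ℝ)) / 2) with hlt | heq | hgt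
        · exact absurd h (ne_of_lt ((Real.rpow_lt_rpow_left_iff hq).mpr hlt))
        · exact heq
        · exact absurd h (ne_of_gt ((Real.rpow_lt_rpow_left_iff hq).mpr hgt))
      have hab : (a : ℝ) = b := mul_left_cancel₀ hd (by linarith)
      exact_mod_cast hab
    · intro a ha
      simp only [Set.mem_setOf_eq] at ha
      by_contra hcon
      apply ha
      simp only [hW, iSup_eq_bot]
      intro μ hμ
      by_contra hne
      exact hcon (Set.mem_biUnion (show μ ∈ {μ : ℂ | T.HasEigenvalue μ} from hne) (by simpa using hμ))
  obtain ⟨M, hM⟩ := hfin.bddAbove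
  refine ⟨(M - c).toNat + 1, fun i hi => ?_⟩
  by_contra hne
  have h := hM (show (c + i) ∈ {a : ℤ | W a ≠ ⊥} from hne)
  omega

/-- The theorem for abstract operators: pure of weight `c` ⟹ every weight-raising `f` commuting with `N` is `0`. -/
theorem eq_zero_of_pure [FiniteDimensional ℂ V] (hq : 1 < (qN : ℝ)) (hd : d ≠ 0)
    (hTN : ∀ v, T (N v) = ((qN : ℂ) ^ d) • N (T v))
    (hfT : ∀ v, f (T v) = ((qN : ℂ) ^ d) • T (f v)) (hfN : ∀ v, f (N v) = N (f v))
    {W : ℤ → Submodule ℂ V}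
    (hW : ∀ a, W a = ⨆ μ : ℂ, ⨆ (_ : ‖μ‖ = (qN : ℝ) ^ (-((d : ℝ) * (a : ℝ)) / 2)), eigenspace T μ)
    {c : ℤ} (hsup : ⨆ a : ℤ, W a = ⊤)
    (hbij : ∀ i : ℕ, Set.BijOn ⇑(N ^ i) ↑(W (c + (i : ℤ))) ↑(W (c - (i : ℤ)))) :
    f = 0 := by
  have hq0 : 0 < (qN : ℝ) := lt_trans zero_lt_one hq
  have hdR : (d : ℝ) ≠ 0 := by exact_mod_cast hd
  obtain ⟨B, hB⟩ := exists_wt_eq_bot T hq hdR hW c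
  -- non-negative weights, by downward induction
  have hpos : ∀ m i : ℕ, B ≤ i + m → ∀ x ∈ W (c + (i : ℤ)), f x = 0 := by
    intro m
    induction m with
    | zero =>
      intro i hi x hx
      rw [hB i (by omega)] at hx
      rw [(Submodule.mem_bot ℂ).mp hx, map_zero]
    | succ m ih =>
      intro i hi x hx
      have ih2 : ∀ z ∈ W (c + ((i + 2 : ℕ) : ℤ)), f z = 0 := ih (i + 2) (by omega)
      -- N^(i+1) x has weight c - (i+2); lift it through the bijection N^(i+2)
      have hNx : (N ^ (i + 1)) x ∈ W (c - ((i + 2 : ℕ) : ℤ)) := by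
        have h := pow_apply_mem_wt hW hq0 hTN (i + 1) hx
        have e : c + (i : ℤ) - 2 * ((i + 1 : ℕ) : ℤ) = c - ((i + 2 : ℕ) : ℤ) := by push_cast; ring
        rw [e] at h; exact h
      obtain ⟨z, hz, hzeq⟩ := (hbij (i + 2)).surjOn hNx
      have hfz : f z = 0 := ih2 z hz
      have hNz : N z ∈ W (c + (i : ℤ)) := by
        have h := apply_mem_wt_sub_two hW hq0 hTN (hz : z ∈ W (c + ((i + 2 : ℕ) : ℤ)))
        have e : c + ((i + 2 : ℕ) : ℤ) - 2 = c + (i : ℤ) := by push_cast; ring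
        rw [e] at h; exact h
      -- the primitive part p := x - N z
      have hp : x - N z ∈ W (c + (i : ℤ)) := sub_mem hx hNz
      have hNp : (N ^ (i + 1)) (x - N z) = 0 := by
        rw [map_sub, sub_eq_zero, ← hzeq, pow_succ, Module.End.mul_apply]
      have hfp : f (x - N z) ∈ W (c + ((i + 2 : ℕ) : ℤ)) := by
        have h := apply_mem_wt_add_two hW hq0 hfT hp
        have e : c + (i : ℤ) + 2 = c + ((i + 2 : ℕ) : ℤ) := by push_cast; ring
        rw [e] at h; exact h
      have hNfp : (N ^ (i + 2)) (f (x - N z)) = 0 := by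
        rw [pow_succ', Module.End.mul_apply, ← apply_pow_apply_comm hfN, hNp, map_zero, map_zero]
      have hfp0 : f (x - N z) = 0 := by
        have h0 : (0 : V) ∈ (W (c + ((i + 2 : ℕ) : ℤ)) : Set V) := Submodule.zero_mem _
        exact (hbij (i + 2)).injOn hfp h0 (by rw [hNfp, map_zero])
      have hx' : x = (x - N z) + N z := by abel
      rw [hx', map_add, hfp0, hfN, hfz, map_zero, add_zero]
  -- every weight
  have hall : ∀ (a : ℤ), ∀ x ∈ W a, f x = 0 := by
    intro a x hx
    rcases le_or_gt c a with hca | hca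
    · obtain ⟨i, rfl⟩ : ∃ i : ℕ, a = c + (i : ℤ) := ⟨(a - c).toNat, by omega⟩
      exact hpos B i (by omega) x hx
    · obtain ⟨i, rfl⟩ : ∃ i : ℕ, a = c - (i : ℤ) := ⟨(c - a).toNat, by omega⟩
      obtain ⟨y, hy, rfl⟩ := (hbij i).surjOn hx
      rw [apply_pow_apply_comm hfN, hpos B i (by omega) y hy, map_zero]
  refine LinearMap.ext fun v => ?_
  rw [LinearMap.zero_apply]
  have hv : v ∈ ⨆ a : ℤ, W a := by rw [hsup]; exact Submodule.mem_top
  exact Submodule.iSup_induction W (motive := fun v => f v = 0) hv hall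
    (map_zero f) (fun x y hx hy => by rw [map_add, hx, hy, add_zero])

end PureImpliesGenericProof

open Literature.NumberTheory.GaloisRepresentations in
/-- **PG (item stmt-Langlands-31689): pure ⟹ generic.**  For every non-archimedean local field `F`, every
Weil–Deligne representation `r` of `W_F` on `ℂⁿ` and every `c : ℤ`: if `r` is pure of weight `c` (inlined predicate
of route PurityCarving) then every `f` with `f ∘ ρ(w) = q ^ deg w • ρ(w) ∘ f` for all `w` and `f N = N f` is zero.
Deligne, Weil II (1980) 1.6; Taylor–Yoshida (2007) Lemma 1.4(4), p. 6 — proved here outright (no named facts). -/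
theorem PureImpliesGeneric_proof : Summit.Langlands.Langlands.Theses.PurityCarving.PureImpliesGeneric := by
  intro F _ _ _ _ n r c hpure f hfw hfN
  obtain ⟨w₀, hd, hsup, hbij⟩ := hpure
  have hq : 1 < (IsNonarchimedeanLocalField.residueFieldCard F : ℝ) := by
    exact_mod_cast IsNonarchimedeanLocalField.one_lt_residueFieldCard F
  have hTN : ∀ v, r.ρ w₀ (r.N v) =
      ((IsNonarchimedeanLocalField.residueFieldCard F : ℂ) ^ WeilGroup.deg w₀) • r.N (r.ρ w₀ v) :=
    r.ρ_N_apply w₀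
  have hfT : ∀ v, f (r.ρ w₀ v) =
      ((IsNonarchimedeanLocalField.residueFieldCard F : ℂ) ^ WeilGroup.deg w₀) • r.ρ w₀ (f v) :=
    fun v => by simpa only [LinearMap.comp_apply, LinearMap.smul_apply] using LinearMap.congr_fun (hfw w₀) v
  have hfN' : ∀ v, f (r.N v) = r.N (f v) := fun v => by
    simpa only [LinearMap.comp_apply] using LinearMap.congr_fun hfN v
  exact PureImpliesGenericProof.eq_zero_of_pure (T := r.ρ w₀) (N := r.N) (f := f) hq hd hTN hfT hfN'
    (W := fun a : ℤ => ⨆ μ : ℂ, ⨆ (_ : ‖μ‖ = (IsNonarchimedeanLocalField.residueFieldCard F : ℝ) ^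
      (-((WeilGroup.deg w₀ : ℝ) * ((a : ℤ) : ℝ)) / 2)), eigenspace (r.ρ w₀) μ) (fun _ => rfl) hsup hbij

end Summit.Langlands.Langlands.Theorems
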